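import Summits.CriticalPhenomena.Ising3DConformalLimit.Theorems.HyperoctahedralRPLimitRotationInvariantAxisSigmaOfUnit
import Summits.CriticalPhenomena.Ising3DConformalLimit.Theorems.HyperoctahedralRPLimitRotationInvariantLimitRegularity
import Summits.CriticalPhenomena.Ising3DConformalLimit.Theorems.HyperoctahedralRPLimitRotationInvariantNineMirrorRP
import Summits.CriticalPhenomena.Ising3DConformalLimit.Theorems.HyperoctahedralRPInversionUpgradeNormalisedGaussianDomination
import Summits.CriticalPhenomena.Ising3DConformalLimit.Theorems.InversionUpgradeNormalised.Negative.AutomaticOrders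
import Summits.CriticalPhenomena.Ising3DConformalLimit.Theorems.RotationUpgradeFromTwoPoint.Negative.NondegeneracyRedundant
import Summits.CriticalPhenomena.Ising3DConformalLimit.Theorems.GaussianScaleMixtureRotationUpgradeFromTwoPointPairingGreedy
import Summits.CriticalPhenomena.Ising3DConformalLimit.Theorems.GaussianScaleMixtureRotationUpgradeFromTwoPointRangeCongruence
import Summits.CriticalPhenomena.Ising3DConformalLimit.Theorems.GaussianScaleMixtureRotationUpgradeFromTwoPointColumnGrowth
import Summits.CriticalPhenomena.Ising3DConformalLimit.Theorems.GaussianScaleMixtureRotationUpgradeFromTwoPointDoubling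
import Literature.Probability.LatticeModels.GaussianPairingBound
import HarnessLib

/-!
# STUB 5'' `stub_interiorUnitSigmaBound` of line `null-laplacian-edge-gaussianity`,
# crux `GaussianScaleMixture.RotationUpgradeFromTwoPoint` (stmt-CriticalPhenomena-8367): the UNIT SIGMA BOUND, proved

Registered stub (verbatim below): on the interior stratum `1/2 < Δ` every instance of the crux hypotheses satisfies
`(sandwich)² ≤ C₁² · (bra OS Gram sum) · (ket OS Gram sum)`, the correlation-function form of `‖e^{-H} σ̂(y) e^{-H}‖ ≤ C₁` on
the Osterwalder–Schrader space of the mirror `x₀ = 0` (the open core shared with crux stmt-1980).  Here `C₁ = R :=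
max 1 (2K Σ_{ℓ≥0} (2(ℓ+1))^{-2Δ})`, `K` the two-point constant of `two_point_le_of_limit`.
Proof = a MULTIPLE-REFLECTION bound (Glimm–Jaffe, *Quantum Physics* (1987) §6.1/§10.5; Fröhlich–Israel–Lieb–Simon 1978 §4).
In the kernel-level OS space `h.Space` of `(EuclideanSpace.single 0 1)^⊥` (`MirrorOSData S (EuclideanSpace.single 0 1)` from the landed `LimitStructure`) put
`φ = Σ_a c_a δ_{A^a}` and the COLUMN vectors `ψ_J = Σ_b d_b δ_{Y_J^b}`, `Y_J^b = (B^b + 2J (EuclideanSpace.single 0 1)) ⊔ {y + (EuclideanSpace.single 0 1), y + 3(EuclideanSpace.single 0 1), …, y + (2J-1)(EuclideanSpace.single 0 1)}`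
(`ψ_J = A₀^J ψ₀` for the SYMMETRIC insertion `A₀ = e^{-H} σ̂(y) e^{-H}`, `y` on the mirror).  Five kernel identities by RANGE
CONGRUENCE (landed `stub_corr_eq_of_range_eq(_add)`): (K1) bra Gram, (K2) ket Gram, (K3) sandwich `= K(X^a, Y_1^b)`,
(K4) `K(Y_J^b, Y_J^{b'}) = K(Y_0^b, Y_{2J}^{b'})` (symmetry of `A₀`), (K5) `K(Y_J^b, Y_J^{b'})` = `S` on the growth configuration of the
landed `stub_column_growth`.  Hence `‖ψ_J‖² = Re⟪ψ_0, ψ_{2J}⟫ ≤ ‖ψ_0‖ ‖ψ_{2J}‖` and, ENTRYWISE, `‖ψ_J‖² ≤ M_ψ R^{2J}` (`S ≥ 0`,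
Newman's Gaussian domination in the limit = landed `stub_gaussianDomination`, greedy hafnian bound = landed `stub_corr_le_prod`,
column row sums `≤ 2K Σ (2ℓ)^{-2Δ} < ∞` exactly when `Δ > 1/2`; the ψ-dependence sits in `J`-independent constants); doubling
(landed `stub_doubling`) gives `‖ψ_1‖ ≤ R ‖ψ_0‖`, and `(sandwich)² = (Re⟪φ, ψ_1⟫)² ≤ ‖φ‖² ‖ψ_1‖² ≤ R² ‖φ‖² ‖ψ_0‖²`.  The
spectral-radius/doubling trick converts the ENTRYWISE growth bound into the FORM bound that termwise inequalities cannot give.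
-/

noncomputable section

open scoped BigOperators InnerProductSpace
open ComplexConjugate
open Literature.Probability.LatticeModels Literature.MathematicalPhysics.QuantumFieldTheory
open Summit.CriticalPhenomena.Ising3DConformalLimit.Cruxes.LimitRotationInvariant.QuarterTurnLiouville

namespace Summit.CriticalPhenomena.Ising3DConformalLimit.Cruxes.RotationUpgradeFromTwoPoint.NullLaplacianEdgeGaussianity


/-! ### Ranges of block configurations -/
/-- The range of an appended configuration of points of `ℝ³` (pointwise form landed as `mem_range_fin_append`). -/
theorem range_fin_append3 {m n : ℕ} (u : Fin m → EuclideanSpace ℝ (Fin 3)) (v : Fin n → EuclideanSpace ℝ (Fin 3)) :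
    Set.range (Fin.append u v) = Set.range u ∪ Set.range v :=
  Set.ext fun _ => by rw [Set.mem_union]; exact mem_range_fin_append
/-- The range of `θ ∘ Fin.append u v` for a map `θ` of `ℝ³`, written pointwise. -/
theorem range_apply_fin_append3 {m n : ℕ} (f : EuclideanSpace ℝ (Fin 3) → EuclideanSpace ℝ (Fin 3)) (u : Fin m → EuclideanSpace ℝ (Fin 3)) (v : Fin n → EuclideanSpace ℝ (Fin 3)) :
    Set.range (fun i => f (Fin.append u v i)) = Set.range (fun i => f (u i)) ∪ Set.range (fun i => f (v i)) := by
  rw [show (fun i => f (Fin.append u v i)) = f ∘ Fin.append u v from rfl, comp_fin_append, range_fin_append3]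
  rfl

/-- A translate of the range of a configuration is the range of the translated configuration (the landed
`range_comp_add`, read from right to left). -/
theorem image_add_range {n : ℕ} (u : Fin n → EuclideanSpace ℝ (Fin 3)) (v : EuclideanSpace ℝ (Fin 3)) :
    (fun p => p + v) '' Set.range u = Set.range (fun i => u i + v) :=
  (range_comp_add u v).symm
/-! ### Vector identities in the frame `(EuclideanSpace.single 0 1)` -/
/-- `θ₀ (u + t (EuclideanSpace.single 0 1)) = θ₀ u - t (EuclideanSpace.single 0 1)`. -/
theorem axisReflection_add_smul_single (u : EuclideanSpace ℝ (Fin 3)) (t : ℝ) :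
    axisReflection 0 (u + t • (EuclideanSpace.single 0 1)) = axisReflection 0 u - t • (EuclideanSpace.single 0 1) := by
  rw [map_add, LinearIsometryEquiv.map_smul, axisReflection_single, smul_neg, sub_eq_add_neg]

/-- For `y` on the mirror, `θ₀ (y + t (EuclideanSpace.single 0 1)) = y - t (EuclideanSpace.single 0 1)`. -/
theorem axisReflection_mirror_add_smul {y : EuclideanSpace ℝ (Fin 3)} (hy : y 0 = 0) (t : ℝ) :
    axisReflection 0 (y + t • (EuclideanSpace.single 0 1)) = y - t • (EuclideanSpace.single 0 1) := by
  rw [axisReflection_add_smul_single, axisReflection_of_apply_eq_zero 0 hy]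

/-! ### Half-space clusters of the frame `(EuclideanSpace.single 0 1)` -/
/-- Points with positive height lie in the open half-space of `(EuclideanSpace.single 0 1)`. -/
theorem pt_pos {p : ℕ} {P : Fin p → EuclideanSpace ℝ (Fin 3)} (hP : ∀ i, 0 < P i 0) : ∀ i, 0 < ⟪P i, (EuclideanSpace.single 0 1)⟫_ℝ :=
  fun i => by rw [inner_single_zero_right]; exact hP i

/-- The column configuration `(P + 2J (EuclideanSpace.single 0 1)) ⊔ {y + (EuclideanSpace.single 0 1), y + 3(EuclideanSpace.single 0 1), …, y + (2J-1)(EuclideanSpace.single 0 1)}` lies in the open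
half-space of `(EuclideanSpace.single 0 1)`. -/
theorem col_pos {y : EuclideanSpace ℝ (Fin 3)} (hy : y 0 = 0) {p : ℕ} {P : Fin p → EuclideanSpace ℝ (Fin 3)} (hP : ∀ i, 0 < P i 0) (J : ℕ) :
    ∀ l, 0 < ⟪Fin.append (fun j => P j + (2 * (J : ℝ)) • (EuclideanSpace.single 0 1))
      (fun i : Fin J => y + (2 * (i : ℝ) + 1) • (EuclideanSpace.single 0 1)) l, (EuclideanSpace.single 0 1)⟫_ℝ := by
  intro l
  refine Fin.addCases (fun j => ?_) (fun i => ?_) l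
  · have := hP j
    rw [Fin.append_left, inner_single_zero_right, PiLp.add_apply, PiLp.smul_apply, PiLp.single_apply]
    simp only [if_true, smul_eq_mul, mul_one]
    positivity
  · rw [Fin.append_right, inner_single_zero_right, PiLp.add_apply, PiLp.smul_apply, PiLp.single_apply, hy]
    simp only [if_true, smul_eq_mul, mul_one]
    positivity

/-! ### Kernel identities -/
/-- (K1) The Gram entries of the bra clusters. -/
theorem kernel_bra (S : CorrFamily 3) {p : ℕ} {P : Fin p → EuclideanSpace ℝ (Fin 3)} (hP : ∀ i, 0 < P i 0)
    {q : ℕ} {Q : Fin q → EuclideanSpace ℝ (Fin 3)} (hQ : ∀ j, 0 < Q j 0) :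
    mirrorKernel S (EuclideanSpace.single 0 1) ⟨p, P, pt_pos hP⟩ ⟨q, Q, pt_pos hQ⟩ =
      S (p + q) (Fin.append (fun i => axisReflection 0 (P i)) Q) := by
  unfold mirrorKernel
  simp only [reflection_span_single_zero]

/-- (K2) The Gram entries of the height-`0` column clusters are the ket Gram entries. -/
theorem kernel_col_zero {S : CorrFamily 3}
    (hR : ∀ (n n' : ℕ), n = n' → ∀ (x : Fin n → EuclideanSpace ℝ (Fin 3)) (x' : Fin n' → EuclideanSpace ℝ (Fin 3)),
      Set.range x = Set.range x' → S n x = S n' x')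
    {y : EuclideanSpace ℝ (Fin 3)} (hy : y 0 = 0) {p : ℕ} {P : Fin p → EuclideanSpace ℝ (Fin 3)} (hP : ∀ i, 0 < P i 0)
    {q : ℕ} {Q : Fin q → EuclideanSpace ℝ (Fin 3)} (hQ : ∀ j, 0 < Q j 0) :
    mirrorKernel S (EuclideanSpace.single 0 1)
        ⟨p + 0, Fin.append (fun j => P j + (2 * ((0 : ℕ) : ℝ)) • (EuclideanSpace.single 0 1))
          (fun i : Fin 0 => y + (2 * (i : ℝ) + 1) • (EuclideanSpace.single 0 1)), col_pos hy hP 0⟩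
        ⟨q + 0, Fin.append (fun j => Q j + (2 * ((0 : ℕ) : ℝ)) • (EuclideanSpace.single 0 1))
          (fun i : Fin 0 => y + (2 * (i : ℝ) + 1) • (EuclideanSpace.single 0 1)), col_pos hy hQ 0⟩ =
      S (p + q) (Fin.append (fun j => axisReflection 0 (P j)) Q) := by
  unfold mirrorKernel
  simp only [reflection_span_single_zero]
  refine hR _ _ (by omega) _ _ ?_
  rw [range_fin_append3, range_apply_fin_append3, range_fin_append3, range_fin_append3]
  simp only [Set.range_eq_empty, Set.union_empty, Nat.cast_zero, mul_zero, zero_smul, add_zero]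

/-- The height-`1` column of one point. -/
theorem range_col_one (y : EuclideanSpace ℝ (Fin 3)) :
    Set.range (fun i : Fin 1 => y + (2 * (i : ℝ) + 1) • (EuclideanSpace.single 0 1)) = {y + (EuclideanSpace.single 0 1)} := by
  rw [Set.range_unique]
  simp

/-- (K3) The mixed entries against the height-`1` column clusters are the sandwich entries. -/
theorem kernel_mixed {S : CorrFamily 3}
    (hRA : ∀ (v : EuclideanSpace ℝ (Fin 3)) (n n' : ℕ), n = n' → ∀ (x : Fin n → EuclideanSpace ℝ (Fin 3)) (x' : Fin n' → EuclideanSpace ℝ (Fin 3)),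
      Set.range x' = (fun p => p + v) '' Set.range x → S n' x' = S n x)
    {y : EuclideanSpace ℝ (Fin 3)} {p : ℕ} {P : Fin p → EuclideanSpace ℝ (Fin 3)} (hP : ∀ i, 0 < P i 0)
    {q : ℕ} {Q : Fin q → EuclideanSpace ℝ (Fin 3)} (hQ : ∀ j, 0 < Q j 0) (hy : y 0 = 0) :
    mirrorKernel S (EuclideanSpace.single 0 1) ⟨p, P, pt_pos hP⟩
        ⟨q + 1, Fin.append (fun j => Q j + (2 * ((1 : ℕ) : ℝ)) • (EuclideanSpace.single 0 1))
          (fun i : Fin 1 => y + (2 * (i : ℝ) + 1) • (EuclideanSpace.single 0 1)), col_pos hy hQ 1⟩ =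
      S (p + 1 + q) (Fin.append (Fin.append (fun i => axisReflection 0 (P i + (EuclideanSpace.single 0 1))) ![y])
        (fun j => Q j + (EuclideanSpace.single 0 1))) := by
  unfold mirrorKernel
  simp only [reflection_span_single_zero]
  refine hRA (EuclideanSpace.single 0 1) _ _ (by omega) _ _ ?_
  rw [range_fin_append3, range_fin_append3, range_col_one, range_fin_append3, range_fin_append3,
    Matrix.range_cons, Matrix.range_empty, Set.union_empty, Set.image_union, Set.image_union,
    image_add_range, image_add_range, Set.image_singleton]
  have h1 : (fun i => axisReflection 0 (P i + (EuclideanSpace.single 0 1)) + (EuclideanSpace.single 0 1)) = fun i => axisReflection 0 (P i) := by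
    funext i
    rw [map_add, axisReflection_single, neg_add_cancel_right]
  have h2 : (fun j => Q j + (EuclideanSpace.single 0 1) + (EuclideanSpace.single 0 1)) = fun j => Q j + (2 * ((1 : ℕ) : ℝ)) • (EuclideanSpace.single 0 1) := by
    funext j
    rw [Nat.cast_one, mul_one, two_smul, add_assoc]
  rw [h1, h2]
  ext v
  simp only [Set.mem_union, Set.mem_singleton_iff]
  tauto

/-- The doubled column: translating the reflected and the unreflected height-`J` columns up by
`2J (EuclideanSpace.single 0 1)` gives the height-`2J` column (`{2J-(2i+1)} ∪ {2J+(2i+1)} = {2m+1 : m < 2J}`). -/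
theorem image_cols {y : EuclideanSpace ℝ (Fin 3)} (hy : y 0 = 0) (J : ℕ) :
    (fun p => p + (2 * (J : ℝ)) • (EuclideanSpace.single 0 1)) '' Set.range (fun i : Fin J => axisReflection 0 (y + (2 * (i : ℝ) + 1) • (EuclideanSpace.single 0 1))) ∪
        (fun p => p + (2 * (J : ℝ)) • (EuclideanSpace.single 0 1)) '' Set.range (fun i : Fin J => y + (2 * (i : ℝ) + 1) • (EuclideanSpace.single 0 1)) =
      Set.range (fun i : Fin (2 * J) => y + (2 * (i : ℝ) + 1) • (EuclideanSpace.single 0 1)) := by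
  rw [image_add_range, image_add_range]
  simp only [axisReflection_mirror_add_smul hy]
  ext v
  simp only [Set.mem_union, Set.mem_range]
  constructor
  · rintro (⟨⟨i, hi⟩, rfl⟩ | ⟨⟨i, hi⟩, rfl⟩)
    · obtain ⟨n, rfl⟩ : ∃ n : ℕ, J = n + i + 1 := ⟨J - 1 - i, by omega⟩
      exact ⟨⟨n, by omega⟩, by push_cast; module⟩
    · exact ⟨⟨J + i, by omega⟩, by push_cast; module⟩
  · rintro ⟨⟨i, hi⟩, rfl⟩
    rcases Nat.lt_or_ge i J with h | h
    · obtain ⟨n, rfl⟩ : ∃ n : ℕ, J = n + i + 1 := ⟨J - 1 - i, by omega⟩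
      exact Or.inl ⟨⟨n, by omega⟩, by push_cast; module⟩
    · obtain ⟨n, rfl⟩ : ∃ n : ℕ, i = J + n := ⟨i - J, by omega⟩
      exact Or.inr ⟨⟨n, by omega⟩, by push_cast; module⟩

/-- (K4) `K(Y_J^b, Y_J^{b'}) = K(Y_0^b, Y_{2J}^{b'})` (`A₀` is symmetric: translate by `2J (EuclideanSpace.single 0 1)`). -/
theorem kernel_col_sq {S : CorrFamily 3}
    (hRA : ∀ (v : EuclideanSpace ℝ (Fin 3)) (n n' : ℕ), n = n' → ∀ (x : Fin n → EuclideanSpace ℝ (Fin 3)) (x' : Fin n' → EuclideanSpace ℝ (Fin 3)),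
      Set.range x' = (fun p => p + v) '' Set.range x → S n' x' = S n x)
    {y : EuclideanSpace ℝ (Fin 3)} (hy : y 0 = 0) {p : ℕ} {P : Fin p → EuclideanSpace ℝ (Fin 3)} (hP : ∀ i, 0 < P i 0)
    {q : ℕ} {Q : Fin q → EuclideanSpace ℝ (Fin 3)} (hQ : ∀ j, 0 < Q j 0) (J : ℕ) :
    mirrorKernel S (EuclideanSpace.single 0 1)
        ⟨p + J, Fin.append (fun j => P j + (2 * (J : ℝ)) • (EuclideanSpace.single 0 1))
          (fun i : Fin J => y + (2 * (i : ℝ) + 1) • (EuclideanSpace.single 0 1)), col_pos hy hP J⟩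
        ⟨q + J, Fin.append (fun j => Q j + (2 * (J : ℝ)) • (EuclideanSpace.single 0 1))
          (fun i : Fin J => y + (2 * (i : ℝ) + 1) • (EuclideanSpace.single 0 1)), col_pos hy hQ J⟩ =
      mirrorKernel S (EuclideanSpace.single 0 1)
        ⟨p + 0, Fin.append (fun j => P j + (2 * ((0 : ℕ) : ℝ)) • (EuclideanSpace.single 0 1))
          (fun i : Fin 0 => y + (2 * (i : ℝ) + 1) • (EuclideanSpace.single 0 1)), col_pos hy hP 0⟩
        ⟨q + 2 * J, Fin.append (fun j => Q j + (2 * ((2 * J : ℕ) : ℝ)) • (EuclideanSpace.single 0 1))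
          (fun i : Fin (2 * J) => y + (2 * (i : ℝ) + 1) • (EuclideanSpace.single 0 1)), col_pos hy hQ (2 * J)⟩ := by
  unfold mirrorKernel
  simp only [reflection_span_single_zero]
  refine (hRA ((2 * (J : ℝ)) • (EuclideanSpace.single 0 1)) _ _ (by omega) _ _ ?_).symm
  rw [range_fin_append3, range_apply_fin_append3, range_fin_append3, range_fin_append3,
    range_apply_fin_append3, range_fin_append3]
  simp only [Set.range_eq_empty, Set.union_empty]
  rw [Set.union_union_union_comm, Set.image_union, Set.image_union, Set.image_union, image_cols hy J,
    image_add_range, image_add_range]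
  have h1 : (fun i => axisReflection 0 (P i + (2 * (J : ℝ)) • (EuclideanSpace.single 0 1)) + (2 * (J : ℝ)) • (EuclideanSpace.single 0 1)) =
      fun i => axisReflection 0 (P i + (2 * ((0 : ℕ) : ℝ)) • (EuclideanSpace.single 0 1)) := by
    funext i
    rw [axisReflection_add_smul_single, sub_add_cancel, Nat.cast_zero, mul_zero, zero_smul, add_zero]
  have h2 : (fun j => Q j + (2 * (J : ℝ)) • (EuclideanSpace.single 0 1) + (2 * (J : ℝ)) • (EuclideanSpace.single 0 1)) =
      fun j => Q j + (2 * ((2 * J : ℕ) : ℝ)) • (EuclideanSpace.single 0 1) := by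
    funext j
    push_cast
    module
  rw [h1, h2, Set.union_assoc]

/-- (K5) `K(Y_J^b, Y_J^{b'})` is the value of `S` on the growth configuration (same range). -/
theorem kernel_col_growth {S : CorrFamily 3}
    (hR : ∀ (n n' : ℕ), n = n' → ∀ (x : Fin n → EuclideanSpace ℝ (Fin 3)) (x' : Fin n' → EuclideanSpace ℝ (Fin 3)),
      Set.range x = Set.range x' → S n x = S n' x')
    {y : EuclideanSpace ℝ (Fin 3)} (hy : y 0 = 0) {p : ℕ} {P : Fin p → EuclideanSpace ℝ (Fin 3)} (hP : ∀ i, 0 < P i 0)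
    {q : ℕ} {Q : Fin q → EuclideanSpace ℝ (Fin 3)} (hQ : ∀ j, 0 < Q j 0) (J : ℕ) :
    mirrorKernel S (EuclideanSpace.single 0 1)
        ⟨p + J, Fin.append (fun j => P j + (2 * (J : ℝ)) • (EuclideanSpace.single 0 1))
          (fun i : Fin J => y + (2 * (i : ℝ) + 1) • (EuclideanSpace.single 0 1)), col_pos hy hP J⟩
        ⟨q + J, Fin.append (fun j => Q j + (2 * (J : ℝ)) • (EuclideanSpace.single 0 1))
          (fun i : Fin J => y + (2 * (i : ℝ) + 1) • (EuclideanSpace.single 0 1)), col_pos hy hQ J⟩ =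
      S ((p + q) + (J + J))
        (Fin.append
          (Fin.append (fun i => axisReflection 0 (P i + (2 * (J : ℝ)) • EuclideanSpace.single 0 1))
            (fun j => Q j + (2 * (J : ℝ)) • EuclideanSpace.single 0 1))
          (Fin.append (fun i : Fin J => y - (2 * (i : ℝ) + 1) • EuclideanSpace.single 0 1)
            (fun i : Fin J => y + (2 * (i : ℝ) + 1) • EuclideanSpace.single 0 1))) := by
  unfold mirrorKernel
  simp only [reflection_span_single_zero]
  refine hR _ _ (by omega) _ _ ?_
  rw [range_fin_append3, range_apply_fin_append3, range_fin_append3, range_fin_append3, range_fin_append3,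
    range_fin_append3]
  simp only [axisReflection_mirror_add_smul hy]
  exact Set.union_union_union_comm _ _ _ _

/-! ### Gram formulas and Cauchy–Schwarz in the OS space of `(EuclideanSpace.single 0 1)^⊥` -/
/-- The mixed Gram formula for real combinations of kernel vectors. -/
theorem re_inner_sum_smul_gen {S : CorrFamily 3} (h : MirrorOSData S (EuclideanSpace.single 0 1)) {m m' : ℕ} (c : Fin m → ℝ)
    (d : Fin m' → ℝ) (X : Fin m → HalfSpaceCluster 3 (EuclideanSpace.single 0 1)) (Y : Fin m' → HalfSpaceCluster 3 (EuclideanSpace.single 0 1)) :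
    (⟪∑ a, (c a : ℂ) • h.gen (X a), ∑ b, (d b : ℂ) • h.gen (Y b)⟫_ℂ).re =
      ∑ a, ∑ b, c a * d b * mirrorKernel S (EuclideanSpace.single 0 1) (X a) (Y b) := by
  rw [sum_inner, Complex.re_sum]
  refine Finset.sum_congr rfl fun a _ => ?_
  rw [inner_sum, Complex.re_sum]
  refine Finset.sum_congr rfl fun b _ => ?_
  rw [inner_smul_left, inner_smul_right, h.inner_gen_gen, Complex.conj_ofReal, ← Complex.ofReal_mul,
    ← Complex.ofReal_mul, Complex.ofReal_re]
  ring

/-- Cauchy–Schwarz for the real part, squared. -/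
theorem re_inner_sq_le {E : Type*} [NormedAddCommGroup E] [InnerProductSpace ℂ E] (u v : E) :
    (⟪u, v⟫_ℂ).re ^ 2 ≤ (‖u‖ * ‖v‖) ^ 2 := by
  have h1 : |(⟪u, v⟫_ℂ).re| ≤ ‖u‖ * ‖v‖ := (Complex.abs_re_le_norm _).trans (norm_inner_le_norm u v)
  calc (⟪u, v⟫_ℂ).re ^ 2 = |(⟪u, v⟫_ℂ).re| ^ 2 := (sq_abs _).symm
    _ ≤ (‖u‖ * ‖v‖) ^ 2 := pow_le_pow_left₀ (abs_nonneg _) h1 2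

/-- The entrywise bound of the growth step. -/
theorem term_bound {d d' s M P : ℝ} (hs0 : 0 ≤ s) (hs : s ≤ M * P) (hP : 0 ≤ P) :
    d * d' * s ≤ |d| * |d'| * max M 0 * P := by
  have h1 : s ≤ max M 0 * P := hs.trans (mul_le_mul_of_nonneg_right (le_max_left _ _) hP)
  calc d * d' * s ≤ |d * d' * s| := le_abs_self _
    _ = |d| * |d'| * s := by rw [abs_mul, abs_mul, abs_of_nonneg hs0]
    _ ≤ |d| * |d'| * (max M 0 * P) := mul_le_mul_of_nonneg_left h1 (mul_nonneg (abs_nonneg _) (abs_nonneg _))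
    _ = |d| * |d'| * max M 0 * P := by ring

/-! ### The assembly -/
/-- **STUB 5'' · `stub_interiorUnitSigmaBound` (registered signature, verbatim) — the frame-`(EuclideanSpace.single 0 1)` UNIT SIGMA BOUND on the
interior stratum.**  For every `(ρ, Δ, S)` with (H1)–(H7), `1/2 < Δ ≤ 1`, `U₄ ≢ 0`, nine-mirror OS positivity and the analytic
layer (the last four groups of hypotheses and (H7) are not used), there is `C₁` such that for every `y` on the mirror `x₀ = 0`
and all finite real combinations of bra clusters `A` / ket clusters `B` in `{x₀ > 0}`,
`(Σ c_a d_b S(θ₀(A^a + (EuclideanSpace.single 0 1)) ⊔ {y} ⊔ (B^b + (EuclideanSpace.single 0 1))))² ≤ C₁² ‖A‖²_OS ‖B‖²_OS`.  Proof: the multiple-reflection bound of the module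
docstring, with `C₁ = max 1 (2K Σ_ℓ (2(ℓ+1))^{-2Δ})`.
[cite: GlimmJaffe1987, §6.1 and §10.5 (multiple reflections); FrohlichEtAl1978, §4 (chessboard estimates); Newman 1975 (Gaussian inequality)] -/
theorem stub_interiorUnitSigmaBound :
    ∀ (ρ : ℝ → ℝ) (Δ : ℝ) (S : CorrFamily 3), (∀ δ ∈ Set.Ioc (0:ℝ) 1, 0 < ρ δ) →
      HasPointwiseScalingLimit (criticalCorr 3) ρ S →
      (∀ n z, z ∉ NonCoincident 3 n → S n z = 0) → IsNondegenerateTwoPoint S →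
      IsTranslationInvariant S → IsScaleCovariant Δ S →
      (∀ (R : EuclideanSpace ℝ (Fin 3) ≃ₗᵢ[ℝ] EuclideanSpace ℝ (Fin 3))
        (x : EuclideanSpace ℝ (Fin 3)), x ≠ 0 → S 2 ![0, R x] = S 2 ![0, x]) →
      1 / 2 < Δ → Δ ≤ 1 → HasNontrivialU4 S →
      (∀ n : EuclideanSpace ℝ (Fin 3),
        (∃ i j : Fin 3, i ≠ j ∧ (n = EuclideanSpace.single i 1 ∨
          n = EuclideanSpace.single i 1 + EuclideanSpace.single j 1 ∨
          n = EuclideanSpace.single i 1 - EuclideanSpace.single j 1)) →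
        ∀ (k : ℕ) (m : Fin k → ℕ) (A : (a : Fin k) → Fin (m a) → EuclideanSpace ℝ (Fin 3))
          (c : Fin k → ℝ), (∀ a i, 0 < inner ℝ (A a i) n) →
          0 ≤ ∑ a, ∑ b, c a * c b *
            S (m a + m b) (Fin.append (fun i => ((ℝ ∙ n)ᗮ).reflection (A a i)) (A b))) →
      (∀ (m : ℕ) (y : Fin m → EuclideanSpace ℝ (Fin 3)), Function.Injective y →
        ∃ F : Finset (EuclideanSpace ℝ (Fin 3)),
          AnalyticOnNhd ℝ (fun x : EuclideanSpace ℝ (Fin 3) => S (m + 1) (Fin.cons x y))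
            (Set.range y ∪ (F : Set (EuclideanSpace ℝ (Fin 3))))ᶜ) →
      ∃ C₁ : ℝ, ∀ y : EuclideanSpace ℝ (Fin 3), y 0 = 0 →
        ∀ (m : ℕ) (k : Fin m → ℕ) (A : (a : Fin m) → Fin (k a) → EuclideanSpace ℝ (Fin 3)) (c : Fin m → ℝ)
          (m' : ℕ) (k' : Fin m' → ℕ) (B : (b : Fin m') → Fin (k' b) → EuclideanSpace ℝ (Fin 3))
          (d : Fin m' → ℝ),
          (∀ a i, 0 < A a i 0) → (∀ b j, 0 < B b j 0) →
          (∑ a, ∑ b, c a * d b * S (k a + 1 + k' b)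
              (Fin.append (Fin.append
                (fun i => axisReflection 0 (A a i + EuclideanSpace.single 0 1)) ![y])
                (fun j => B b j + EuclideanSpace.single 0 1))) ^ 2
            ≤ C₁ ^ 2 *
              (∑ a, ∑ a', c a * c a' * S (k a + k a')
                (Fin.append (fun i => axisReflection 0 (A a i)) (A a'))) *
              (∑ b, ∑ b', d b * d b' * S (k' b + k' b')
                (Fin.append (fun j => axisReflection 0 (B b j)) (B b'))) := by
  intro ρ Δ S hρ hlim hnorm hnd htr hsc _ hΔ _ _ _ _
  -- Step 0: the structure of the limit
  have hH : CruxHyp ρ Δ S := ⟨hρ, hlim, hnorm, hnd, htr, hsc⟩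
  have hL : LimitStructure Δ S :=
    ⟨LimitRotationInvariant.QuarterTurnLiouville.stub_limitRegularity ρ Δ S hH,
      LimitRotationInvariant.QuarterTurnLiouville.stub_nineMirrorRP ρ Δ S hH⟩
  have h : MirrorOSData S (EuclideanSpace.single 0 1) := mirrorOSData_latticeNormal hL single_zero_mem
  obtain ⟨-, -, -, -, -, hO, hperm, -, -⟩ := hL.1
  have hrefl2 : ∀ p q : EuclideanSpace ℝ (Fin 3), S 2 ![axisReflection 0 p, axisReflection 0 q] = S 2 ![p, q] := by
    intro p q
    have h1 := reflInvariant_latticeNormal hO single_zero_mem 2 ![p, q]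
    have h2 : (fun i => refl (EuclideanSpace.single 0 1) ((![p, q] : Fin 2 → EuclideanSpace ℝ (Fin 3)) i)) = ![axisReflection 0 p, axisReflection 0 q] := by
      funext i; fin_cases i; exacts [refl_single_zero p, refl_single_zero q]
    rwa [h2] at h1
  have hSnn : ∀ (n : ℕ) (x : Fin n → EuclideanSpace ℝ (Fin 3)), 0 ≤ S n x := by
    intro n x
    by_cases hx : x ∈ NonCoincident 3 n
    · exact RotationUpgradeFromTwoPointNegative.limit_nonneg hρ hlim hx
    · exact (hnorm n x hx).ge
  have h2nn : ∀ a b : EuclideanSpace ℝ (Fin 3), 0 ≤ S 2 ![a, b] := fun a b => hSnn 2 _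
  have hdiag : ∀ p : EuclideanSpace ℝ (Fin 3), S 2 ![p, p] = 0 := fun p => hnorm 2 _ fun hinj => by
    rw [mem_nonCoincident] at hinj
    exact absurd (hinj (show (![p, p] : Fin 2 → EuclideanSpace ℝ (Fin 3)) 0 = ![p, p] 1 from rfl)) (by decide)
  obtain ⟨K, hK1, h2pt⟩ := two_point_le_of_limit hρ hlim hnd htr hsc
  have hK0 : (0 : ℝ) ≤ K := zero_le_one.trans hK1
  have hGD := InversionUpgradeNormalised.FreeEndpointGaussianClosure.stub_gaussianDomination ρ S hρ hlim
  have hodd : ∀ (n : ℕ) (x : Fin n → EuclideanSpace ℝ (Fin 3)), Odd n → S n x = 0 := fun n x hn =>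
    InversionUpgradeNormalisedNegative.limit_odd_eq_zero hlim hnorm hn x
  have hrow := stub_corr_le_prod S hGD hodd hnorm h2nn
  have hMex := stub_column_growth Δ K S hΔ hK0 hrow h2pt h2nn hdiag htr hrefl2
  set R : ℝ := max 1 (2 * K * ∑' ℓ : ℕ, ((2 : ℝ) * ((ℓ : ℝ) + 1)) ^ (-(2 * Δ)))
  have hR1 : 1 ≤ R := le_max_left _ _
  have hR0 : 0 ≤ R := zero_le_one.trans hR1
  have hRS := stub_corr_eq_of_range_eq S hnorm hperm
  have hRAS := stub_corr_eq_of_range_eq_add S hnorm hperm htr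
  refine ⟨R, fun y hy m k A c m' k' B d hA hB => ?_⟩
  -- Step 1: the bra vector `φ` and the column vectors `ψ J`
  choose M hM using fun b b' => hMex y hy (k' b) (B b) (k' b') (B b') (hB b) (hB b')
  set φ : h.Space := ∑ a, (c a : ℂ) • h.gen ⟨k a, A a, pt_pos (hA a)⟩ with hφ
  obtain ⟨ψ, hψ⟩ : ∃ ψ : ℕ → h.Space, ∀ J, ψ J = ∑ b, (d b : ℂ) • h.gen ⟨k' b + J,
      Fin.append (fun j => B b j + (2 * (J : ℝ)) • (EuclideanSpace.single 0 1)) (fun i : Fin J => y + (2 * (i : ℝ) + 1) • (EuclideanSpace.single 0 1)),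
      col_pos hy (hB b) J⟩ := ⟨_, fun J => rfl⟩
  -- Step 2: Gram identities (K1), (K2), (K3)
  have hGA : ‖φ‖ ^ 2 = ∑ a, ∑ a', c a * c a' * S (k a + k a')
      (Fin.append (fun i => axisReflection 0 (A a i)) (A a')) := by
    rw [hφ, norm_sum_smul_gen_sq h c]
    refine Finset.sum_congr rfl fun a _ => Finset.sum_congr rfl fun a' _ => ?_
    rw [kernel_bra S (hA a) (hA a')]
  have hGB : ‖ψ 0‖ ^ 2 = ∑ b, ∑ b', d b * d b' * S (k' b + k' b')
      (Fin.append (fun j => axisReflection 0 (B b j)) (B b')) := by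
    rw [hψ 0, norm_sum_smul_gen_sq h d]
    refine Finset.sum_congr rfl fun b _ => Finset.sum_congr rfl fun b' _ => ?_
    rw [kernel_col_zero hRS hy (hB b) (hB b')]
  have hmix : (∑ a, ∑ b, c a * d b * S (k a + 1 + k' b)
      (Fin.append (Fin.append (fun i => axisReflection 0 (A a i + EuclideanSpace.single 0 1)) ![y])
        (fun j => B b j + EuclideanSpace.single 0 1))) = (⟪φ, ψ 1⟫_ℂ).re := by
    rw [hφ, hψ 1, re_inner_sum_smul_gen h c d]
    refine Finset.sum_congr rfl fun a _ => Finset.sum_congr rfl fun b _ => ?_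
    rw [kernel_mixed hRAS (hA a) (hB b) hy]
  -- Step 3: (K4) + Cauchy–Schwarz, (K5) + growth, doubling
  have hF1 : ∀ J, ‖ψ J‖ ^ 2 ≤ ‖ψ 0‖ * ‖ψ (2 * J)‖ := fun J => by
    have e : ‖ψ J‖ ^ 2 = (⟪ψ 0, ψ (2 * J)⟫_ℂ).re := by
      rw [hψ J, hψ 0, hψ (2 * J), norm_sum_smul_gen_sq h d, re_inner_sum_smul_gen h d d]
      refine Finset.sum_congr rfl fun b _ => Finset.sum_congr rfl fun b' _ => ?_
      rw [kernel_col_sq hRAS hy (hB b) (hB b') J]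
    rw [e]
    exact ((le_abs_self _).trans (Complex.abs_re_le_norm _)).trans (norm_inner_le_norm (ψ 0) (ψ (2 * J)))
  have hMψ0 : 0 ≤ ∑ b, ∑ b', |d b| * |d b'| * max (M b b') 0 :=
    Finset.sum_nonneg fun b _ => Finset.sum_nonneg fun b' _ =>
      mul_nonneg (mul_nonneg (abs_nonneg _) (abs_nonneg _)) (le_max_right _ _)
  have hF2 : ∀ J, ‖ψ J‖ ^ 2 ≤ (∑ b, ∑ b', |d b| * |d b'| * max (M b b') 0) * R ^ (2 * J) := fun J => by
    rw [hψ J, norm_sum_smul_gen_sq h d, Finset.sum_mul]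
    refine Finset.sum_le_sum fun b _ => ?_
    rw [Finset.sum_mul]
    refine Finset.sum_le_sum fun b' _ => ?_
    rw [kernel_col_growth hRS hy (hB b) (hB b') J]
    exact term_bound (hSnn _ _) (hM b b' J) (pow_nonneg hR0 _)
  have hψ1 : ‖ψ 1‖ ≤ ‖ψ 0‖ * R :=
    stub_doubling (fun J => ‖ψ J‖) ‖ψ 0‖ R _ (fun _ => norm_nonneg _) (norm_nonneg _) hR1 hMψ0
      (fun J _ => hF1 J) hF2
  -- Step 4: conclusion
  rw [hmix, ← hGA, ← hGB]
  calc (⟪φ, ψ 1⟫_ℂ).re ^ 2 ≤ (‖φ‖ * ‖ψ 1‖) ^ 2 := re_inner_sq_le φ (ψ 1)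
    _ ≤ (‖φ‖ * (‖ψ 0‖ * R)) ^ 2 :=
        pow_le_pow_left₀ (by positivity) (mul_le_mul_of_nonneg_left hψ1 (norm_nonneg _)) 2
    _ = R ^ 2 * ‖φ‖ ^ 2 * ‖ψ 0‖ ^ 2 := by ring

end Summit.CriticalPhenomena.Ising3DConformalLimit.Cruxes.RotationUpgradeFromTwoPoint.NullLaplacianEdgeGaussianity

end
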